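import Summits.Ventures.HodgeRepro2.T5SU11KernelTwoSidedBound
import Summits.Ventures.HodgeRepro2.T5SU11ResolventNeumannUniform
import Summits.Ventures.HodgeRepro2.T5SU11ResolventIterateHilbert
import Summits.Ventures.HodgeRepro2.T5SU11KernelCompositionSymmetric

/-!
# The Neumann series of the kernel converges uniformly in `(t, s)` away from the corner

Row 577 gave the kernel's Neumann series `K_λ(t, s) = Σ_k (μ − μ₂)^k K_{λ₂}^{∘(k+1)}(t, s)` pointwise on the sharp disc
`|μ − μ₂| < (λ₂ − 1)²`. With row 600's uniform `W_1` constant `C Ξ(s)` of the kernel sources `K_{λ₂}(·, s)`, `s ≥ a`, row 587's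
explicit remainder of the resolvent's Neumann series on `W_1` becomes a remainder of the kernel's series that is uniform in
`(t, s) ∈ (0, ∞) × [a, ∞)`:

* `kernel_sub_partial_sum_eq` — the exact identity
  `K_λ(t, s) − Σ_{k<n+2} (μ − μ₂)^k K_{λ₂}^{∘(k+1)}(t, s) = (μ − μ₂) (G^I_λ k_s(t) − Σ_{k<n+1} (μ − μ₂)^k (G^I_{λ₂})^{k+1} k_s(t))`;
* `exists_kernel_neumann_remainder_le` — **`|K_λ(t, s) − Σ_{k<n+2} (μ − μ₂)^k K_{λ₂}^{∘(k+1)}(t, s)|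
  ≤ |μ − μ₂| C Ξ(t) Ξ(s)/(λ − 1)² · (|μ − μ₂|/(λ₂ − 1)²)^{n+1}`** for `t > 0`, `s ≥ a`, every `λ, λ₂ > 1`;
* `tendstoUniformlyOn_kernel_neumann` — **on the sharp disc the partial sums converge to `K_λ` uniformly on `(0, ∞) × [a, ∞)`**;
* `tendstoUniformlyOn_kernel_neumann'` — the same on `{max(t, s) ≥ a}` (symmetry of the composed kernels, row 582).

The corner `t, s → 0` is excluded for the reason recorded in row 600 (the logarithmic singularity of the kernel).
Nothing is claimed about (N).

Blind lane: Mathlib + the HodgeRepro2 prefix only; no sorry; axioms ⊆ {propext, Classical.choice,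
Quot.sound}.
-/

namespace Summit.Ventures.HodgeRepro2.T5SU11KernelNeumannUniform

open Filter Topology MeasureTheory
open Set (Ioi Ioc)
open T5SU11Cartan T5SU11SphericalFunction T5SU11SphericalBounds T5SU11SphericalDecay T5SU11RadialGreenKernel
  T5SU11RadialGreenImproper T5SU11KernelDifferenceRegularity T5SU11KernelTwoSidedBound T5SU11ResolventNeumannUniform
  T5SU11ResolventIterateHilbert T5SU11KernelCompositionSymmetric

section measure

variable [MeasurableSpace Circle] [BorelSpace Circle]

variable {lam lam₂ : ℝ} (hlam : 1 < lam) (hlam₂ : 1 < lam₂)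

include hlam hlam₂ in
/-- **The exact form of the kernel's Neumann remainder**: for `t, s > 0`,
`K_λ(t, s) − Σ_{k<n+2} (μ − μ₂)^k K_{λ₂}^{∘(k+1)}(t, s) = (μ − μ₂) (G^I_λ k_s(t) − Σ_{k<n+1} (μ − μ₂)^k (G^I_{λ₂})^{k+1} k_s(t))`,
`k_s = K_{λ₂}(·, s)`. -/
theorem kernel_sub_partial_sum_eq {s : ℝ} (hs : 0 < s) (n : ℕ) {t : ℝ} (ht : 0 < t) :
    sphGreenKernel lam t s - ∑ k ∈ Finset.range (n + 2), (lam * (lam - 2) - lam₂ * (lam₂ - 2)) ^ k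
        * ((greenSolI (fun t => sph lam₂ (hyp t)) (sphDecay lam₂))^[k] (fun r => sphGreenKernel lam₂ r s)) t
      = (lam * (lam - 2) - lam₂ * (lam₂ - 2))
        * (greenSolI (fun t => sph lam (hyp t)) (sphDecay lam) (fun r => sphGreenKernel lam₂ r s) t
          - ∑ k ∈ Finset.range (n + 1), (lam * (lam - 2) - lam₂ * (lam₂ - 2)) ^ k
            * ((greenSolI (fun t => sph lam₂ (hyp t)) (sphDecay lam₂))^[k + 1] (fun r => sphGreenKernel lam₂ r s)) t) := by
  have hid := kernel_sub_kernel_eq_greenSolI hlam hlam₂ hs ht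
  have hsplit := Finset.sum_range_succ' (fun k => (lam * (lam - 2) - lam₂ * (lam₂ - 2)) ^ k
    * ((greenSolI (fun t => sph lam₂ (hyp t)) (sphDecay lam₂))^[k] (fun r => sphGreenKernel lam₂ r s)) t) (n + 1)
  rw [hsplit, mul_sub (lam * (lam - 2) - lam₂ * (lam₂ - 2)), Finset.mul_sum]
  simp only [pow_zero, one_mul, Function.iterate_zero, id_eq]
  have e : ∀ k ∈ Finset.range (n + 1), (lam * (lam - 2) - lam₂ * (lam₂ - 2)) ^ (k + 1)
        * ((greenSolI (fun t => sph lam₂ (hyp t)) (sphDecay lam₂))^[k + 1] (fun r => sphGreenKernel lam₂ r s)) t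
      = (lam * (lam - 2) - lam₂ * (lam₂ - 2)) * ((lam * (lam - 2) - lam₂ * (lam₂ - 2)) ^ k
        * ((greenSolI (fun t => sph lam₂ (hyp t)) (sphDecay lam₂))^[k + 1] (fun r => sphGreenKernel lam₂ r s)) t) := by
    intro k _
    ring
  rw [Finset.sum_congr rfl e]
  linarith [hid]

include hlam hlam₂ in
/-- **THE KERNEL'S NEUMANN REMAINDER, UNIFORMLY IN `(t, s)` AWAY FROM THE CORNER**: for every `a > 0` there is `C > 0` with
`|K_λ(t, s) − Σ_{k<n+2} (μ − μ₂)^k K_{λ₂}^{∘(k+1)}(t, s)| ≤ |μ − μ₂| · C Ξ(s) Ξ(t)/(λ − 1)² · (|μ − μ₂|/(λ₂ − 1)²)^{n+1}`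
for all `t > 0`, `s ≥ a` and `n`. -/
theorem exists_kernel_neumann_remainder_le {a : ℝ} (ha : 0 < a) :
    ∃ C : ℝ, 0 < C ∧ ∀ t s, 0 < t → a ≤ s → ∀ n : ℕ,
      |sphGreenKernel lam t s - ∑ k ∈ Finset.range (n + 2), (lam * (lam - 2) - lam₂ * (lam₂ - 2)) ^ k
          * ((greenSolI (fun t => sph lam₂ (hyp t)) (sphDecay lam₂))^[k] (fun r => sphGreenKernel lam₂ r s)) t|
        ≤ |lam * (lam - 2) - lam₂ * (lam₂ - 2)| * (C * sph 1 (hyp s) * sph 1 (hyp t) / (lam - 1) ^ 2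
          * (|lam * (lam - 2) - lam₂ * (lam₂ - 2)| / (lam₂ - 1) ^ 2) ^ (n + 1)) := by
  obtain ⟨C, hC, hC'⟩ := exists_kernel_source_le_mul_sph_one_uniform hlam₂ ha
  refine ⟨C, hC, fun t s ht hs n => ?_⟩
  have hs0 : 0 < s := lt_of_lt_of_le ha hs
  have hg := kernel_source_continuousOn hlam₂ hs0
  have hD : ∀ r, 0 < r → |sphGreenKernel lam₂ r s| ≤ (C * sph 1 (hyp s)) * sph 1 (hyp r) := hC' s hs
  have h := neumann_remainder_le hlam hlam₂ hg hD n ht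
  rw [kernel_sub_partial_sum_eq hlam hlam₂ hs0 n ht, abs_mul]
  exact mul_le_mul_of_nonneg_left h (abs_nonneg _)

include hlam₂ in
/-- The partial sums of the kernel's Neumann series are symmetric in `(t, s)` (row 582). -/
theorem partial_sum_symm (n : ℕ) {t s : ℝ} (ht : 0 < t) (hs : 0 < s) :
    ∑ k ∈ Finset.range n, (lam * (lam - 2) - lam₂ * (lam₂ - 2)) ^ k
        * ((greenSolI (fun t => sph lam₂ (hyp t)) (sphDecay lam₂))^[k] (fun r => sphGreenKernel lam₂ r s)) t
      = ∑ k ∈ Finset.range n, (lam * (lam - 2) - lam₂ * (lam₂ - 2)) ^ k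
        * ((greenSolI (fun t => sph lam₂ (hyp t)) (sphDecay lam₂))^[k] (fun r => sphGreenKernel lam₂ r t)) s := by
  refine Finset.sum_congr rfl (fun k _ => ?_)
  rw [kernel_comp_symm hlam₂ k ht hs]

include hlam hlam₂ in
/-- The remainder bound on the region `max(t, s) ≥ a` (symmetry of the kernel and of its composed kernels). -/
theorem exists_kernel_neumann_remainder_le_of_le_max {a : ℝ} (ha : 0 < a) :
    ∃ C : ℝ, 0 < C ∧ ∀ t s, 0 < t → 0 < s → a ≤ max t s → ∀ n : ℕ,
      |sphGreenKernel lam t s - ∑ k ∈ Finset.range (n + 2), (lam * (lam - 2) - lam₂ * (lam₂ - 2)) ^ k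
          * ((greenSolI (fun t => sph lam₂ (hyp t)) (sphDecay lam₂))^[k] (fun r => sphGreenKernel lam₂ r s)) t|
        ≤ |lam * (lam - 2) - lam₂ * (lam₂ - 2)| * (C * sph 1 (hyp s) * sph 1 (hyp t) / (lam - 1) ^ 2
          * (|lam * (lam - 2) - lam₂ * (lam₂ - 2)| / (lam₂ - 1) ^ 2) ^ (n + 1)) := by
  obtain ⟨C, hC, hC'⟩ := exists_kernel_neumann_remainder_le hlam hlam₂ ha
  refine ⟨C, hC, fun t s ht hs hm n => ?_⟩
  rcases le_total t s with hts | hst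
  · rw [max_eq_right hts] at hm
    exact hC' t s ht hm n
  · rw [max_eq_left hst] at hm
    rw [sphGreenKernel_symm, partial_sum_symm hlam₂ (n + 2) ht hs, mul_right_comm C (sph 1 (hyp s))]
    exact hC' s t hs hm n

include hlam hlam₂ in
/-- **THE KERNEL'S NEUMANN SERIES CONVERGES UNIFORMLY AWAY FROM THE CORNER**: for `|μ − μ₂| < (λ₂ − 1)²` the partial sums
`Σ_{k<n} (μ − μ₂)^k K_{λ₂}^{∘(k+1)}(t, s)` converge to `K_λ(t, s)` uniformly in `(t, s)` on `{t, s > 0, max(t, s) ≥ a}`. -/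
theorem tendstoUniformlyOn_kernel_neumann_of_le_max {a : ℝ} (ha : 0 < a)
    (hq : |lam * (lam - 2) - lam₂ * (lam₂ - 2)| < (lam₂ - 1) ^ 2) :
    TendstoUniformlyOn
      (fun n (p : ℝ × ℝ) => ∑ k ∈ Finset.range n, (lam * (lam - 2) - lam₂ * (lam₂ - 2)) ^ k
        * ((greenSolI (fun t => sph lam₂ (hyp t)) (sphDecay lam₂))^[k] (fun r => sphGreenKernel lam₂ r p.2)) p.1)
      (fun p => sphGreenKernel lam p.1 p.2) atTop {p : ℝ × ℝ | 0 < p.1 ∧ 0 < p.2 ∧ a ≤ max p.1 p.2} := by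
  obtain ⟨C, hC, hC'⟩ := exists_kernel_neumann_remainder_le_of_le_max hlam hlam₂ ha
  rw [Metric.tendstoUniformlyOn_iff]
  intro ε hε
  have hr : 0 < (lam₂ - 1) ^ 2 := by
    have : 0 < lam₂ - 1 := by linarith
    positivity
  have hL : 0 < (lam - 1) ^ 2 := by
    have : 0 < lam - 1 := by linarith
    positivity
  have hq0 : 0 ≤ |lam * (lam - 2) - lam₂ * (lam₂ - 2)| / (lam₂ - 1) ^ 2 := div_nonneg (abs_nonneg _) hr.le
  have hq1 : |lam * (lam - 2) - lam₂ * (lam₂ - 2)| / (lam₂ - 1) ^ 2 < 1 := (div_lt_one hr).mpr hq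
  have htend : Tendsto (fun n : ℕ => |lam * (lam - 2) - lam₂ * (lam₂ - 2)| * (C / (lam - 1) ^ 2)
      * (|lam * (lam - 2) - lam₂ * (lam₂ - 2)| / (lam₂ - 1) ^ 2) ^ n) atTop (𝓝 0) := by
    simpa using (tendsto_pow_atTop_nhds_zero_of_lt_one hq0 hq1).const_mul
      (|lam * (lam - 2) - lam₂ * (lam₂ - 2)| * (C / (lam - 1) ^ 2))
  have hev := (tendsto_order.1 htend).2 ε hε
  obtain ⟨N, hN⟩ := eventually_atTop.mp hev
  filter_upwards [eventually_ge_atTop (N + 2)] with n hn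
  rintro ⟨t, s⟩ ⟨ht, hs, hm⟩
  obtain ⟨m, rfl⟩ : ∃ m, n = m + 2 := ⟨n - 2, by omega⟩
  rw [Real.dist_eq]
  refine lt_of_le_of_lt (hC' t s ht hs hm m) ?_
  have hΞt : sph 1 (hyp t) ≤ 1 := sph_hyp_le_one zero_le_one one_le_two t
  have hΞs : sph 1 (hyp s) ≤ 1 := sph_hyp_le_one zero_le_one one_le_two s
  have hΞt0 : 0 < sph 1 (hyp t) := sph_hyp_pos 1 t
  have hqpow : 0 ≤ (|lam * (lam - 2) - lam₂ * (lam₂ - 2)| / (lam₂ - 1) ^ 2) ^ (m + 1) := pow_nonneg hq0 _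
  calc |lam * (lam - 2) - lam₂ * (lam₂ - 2)| * (C * sph 1 (hyp s) * sph 1 (hyp t) / (lam - 1) ^ 2
        * (|lam * (lam - 2) - lam₂ * (lam₂ - 2)| / (lam₂ - 1) ^ 2) ^ (m + 1))
      ≤ |lam * (lam - 2) - lam₂ * (lam₂ - 2)| * (C * 1 * 1 / (lam - 1) ^ 2
        * (|lam * (lam - 2) - lam₂ * (lam₂ - 2)| / (lam₂ - 1) ^ 2) ^ (m + 1)) := by
        apply mul_le_mul_of_nonneg_left _ (abs_nonneg _)
        apply mul_le_mul_of_nonneg_right _ hqpow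
        apply div_le_div_of_nonneg_right _ hL.le
        exact mul_le_mul (mul_le_mul_of_nonneg_left hΞs hC.le) hΞt hΞt0.le (by positivity)
    _ = |lam * (lam - 2) - lam₂ * (lam₂ - 2)| * (C / (lam - 1) ^ 2)
        * (|lam * (lam - 2) - lam₂ * (lam₂ - 2)| / (lam₂ - 1) ^ 2) ^ (m + 1) := by ring
    _ < ε := hN (m + 1) (by omega)

include hlam hlam₂ in
/-- **THE KERNEL'S NEUMANN SERIES CONVERGES UNIFORMLY ON `(0, ∞) × [a, ∞)`** for `|μ − μ₂| < (λ₂ − 1)²`. -/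
theorem tendstoUniformlyOn_kernel_neumann {a : ℝ} (ha : 0 < a)
    (hq : |lam * (lam - 2) - lam₂ * (lam₂ - 2)| < (lam₂ - 1) ^ 2) :
    TendstoUniformlyOn
      (fun n (p : ℝ × ℝ) => ∑ k ∈ Finset.range n, (lam * (lam - 2) - lam₂ * (lam₂ - 2)) ^ k
        * ((greenSolI (fun t => sph lam₂ (hyp t)) (sphDecay lam₂))^[k] (fun r => sphGreenKernel lam₂ r p.2)) p.1)
      (fun p => sphGreenKernel lam p.1 p.2) atTop {p : ℝ × ℝ | 0 < p.1 ∧ a ≤ p.2} :=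
  (tendstoUniformlyOn_kernel_neumann_of_le_max hlam hlam₂ ha hq).mono
    (fun _ hp => ⟨hp.1, lt_of_lt_of_le ha hp.2, le_trans hp.2 (le_max_right _ _)⟩)

end measure

end Summit.Ventures.HodgeRepro2.T5SU11KernelNeumannUniform
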